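import Literature.AlgebraicGeometry.ModuliOfAbelianVarieties.SiegelFamilyIsogenyInducedPolarisation
import HarnessLib

/-!
# Orr's complexity on the Siegel family: the set of isogeny degrees `X_{Z'} → X_Z` is `Sp_{2g}(ℤ)`-bi-invariant
# (so the complexity descends to `𝒜_g = Sp_{2g}(ℤ)\𝔥_g`), contains `1` iff `X_{Z'} ≅ X_Z`, is multiplicative
# under composition (complexity is submultiplicative), and has a least element on every isogeny class

Layer `Literature/AlgebraicGeometry/ModuliOfAbelianVarieties`, namespace
`Literature.AlgebraicGeometry.ModuliOfAbelianVarieties.SiegelModuli`; lane `lit-hodgefound` (Track 2, Layer A4), seat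
`lit-hodgefound-skel-4`, row A4-152 of `run/shared/lean/pub/lit-hodgefound/SKELETON.md` — structural complement of rows
A4-143 (`isLeast_natCard_ker_setOf_isIsogeny…`: the complexity in examples), A4-145 (`setOf_natCard_ker_isIsogeny_comm`:
the degree set is SYMMETRIC), A4-147 (the adjugate: `d ∈ D ⟹ d^{2g-1} ∈ D`ᵒᵖ) and A4-150 (on Picard number one
`D ⊆ {n^g}`), using the Kaehler layer's `ComplexTorusIsomorphism` (`IsIsomorphic`, `isIsomorphic_of_matrix`,
`IsIsomorphic.exists_matrix`) and p17's `isIsomorphic_prinPeriod_smul_of_mem_siegelModularGroup` (`X_{M(Z)} ≅ X_Z` for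
`M ∈ Sp_{2g}(ℤ)`).  THEOREMS ONLY (D-0026, net debt 0; no `def` — the degree set and its least element are written out).

## Source, verbatim (`paper:arxiv-1209.3653` = Orr 2015, §3 p0008 L14–L15)

«We define the complexity of a point `t ∈ Λ` to be the minimum degree of an isogeny `A_s → A_t` between the abelian
varieties corresponding to the points `s` and `t` of `𝒜_g`.  We may also talk about the complexity of a point in `Λ̃`
[`= π⁻¹(Λ) ∩ F_g ⊂ 𝔥_g`], meaning the complexity of its image in `Λ`» — so the complexity is a function on
`𝒜_g × 𝒜_g = (Sp_{2g}(ℤ)\𝔥_g)²`, i.e. `Sp_{2g}(ℤ)`-invariant in both variables on `𝔥_g`; H. Lange, *Abelian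
Varieties over the Complex Numbers* (2023) §1.1.2 Prop. 1.1.13 (p0022: `deg = |det ρ_r|`, hence multiplicative),
§3.1.4 Thm. 3.1.12 / Remark 3.1.14 (p0162–p0163: `X_{M(Z)} ≅ X_Z` for `M ∈ Sp_{2g}(ℤ)`), §1.1.6 Exercise (5)(b) (p0027:
isomorphisms are the `ρ(R)`, `R ∈ GL(ℤ)`, with `ℂ`-linear analytic representation).

## What is proved (`D(Z', Z) := {deg A | A : X_{Z'} → X_Z an isogeny} ⊆ ℕ`, written out as a set-builder)

* `natCard_ker_mul` (**`deg(A₂A₁) = deg A₂ · deg A₁`**), `one_le_of_mem_setOf_natCard_ker_isIsogeny` (degrees are `≥ 1`),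
  `setOf_natCard_ker_isIsogeny_nonempty_iff` (`D ≠ ∅ ⟺ X_{Z'} ∼ X_Z`), **`exists_isLeast_setOf_natCard_ker_isIsogeny`**
  (the complexity EXISTS on the isogeny class).
* **`exists_isIsogeny_natCard_ker_eq_one_iff_isIsomorphic`** (`1 ∈ D(Z', Z) ⟺ X_{Z'} ≅ X_Z`) and
  **`isLeast_setOf_natCard_ker_isIsogeny_one_iff`** (COMPLEXITY `1` ⟺ ISOMORPHIC tori).
* **`mul_mem_setOf_natCard_ker_isIsogeny`** (`D(Z'', Z')·D(Z', Z) ⊆ D(Z'', Z)`) and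
  **`isLeast_le_mul_of_isLeast`** (COMPLEXITY IS SUBMULTIPLICATIVE: `c(Z'', Z) ≤ c(Z', Z)·c(Z'', Z')`).
* **`setOf_natCard_ker_isIsogeny_eq_of_isIsomorphic_left/right`** (the degree set depends only on the isomorphism
  classes) and **`setOf_natCard_ker_isIsogeny_smul_of_mem_siegelModularGroup_left/right`** (**`Sp_{2g}(ℤ)`-BI-INVARIANCE:
  `D(M·Z', Z) = D(Z', Z) = D(Z', M·Z)`** — Orr's complexity descends to `𝒜_g`).

## References

* [Orr2013] M. Orr, J. reine angew. Math. 705 (2015), §3 (p0008 L14–L15), §3.1 (p0009).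
* [Lange2023AbelianVarietiesComplex] H. Lange, Springer (2023), §1.1.2 Prop. 1.1.13 (p0022), §1.1.6 Exercise (5)(b) (p0027),
  §3.1.4 Thm. 3.1.12, Remark 3.1.14 (p0162–p0163).
-/

noncomputable section

open Matrix Module Function Set
open scoped Matrix

namespace Literature.AlgebraicGeometry.ModuliOfAbelianVarieties

namespace SiegelModuli

open Literature.NumberTheory.Automorphic (siegelUpperHalfSpace)
open Literature.NumberTheory.ModularForms Literature.NumberTheory.ModularForms.SiegelUpperHalfSpace
open Literature.NumberTheory.ComplexMultiplication
open Literature.Geometry.Kaehler Literature.Geometry.Kaehler.ComplexTorus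

variable {g : ℕ}

/-! ## §1 Degrees multiply; the degree set; existence of the complexity -/

section DegreeSet

variable (Z Z' Z'' : siegelUpperHalfSpace g)

/-- **`deg(A₂ ∘ A₁) = deg A₂ · deg A₁`** for integer matrices `X_{Z''} →^{A₁} X_{Z'} →^{A₂} X_Z` (`deg = |det|`).
[cite: Lange2023AbelianVarietiesComplex, §1.1.2 Prop. 1.1.13 (p0022)] -/
theorem natCard_ker_mul (A₂ A₁ : Matrix (Fin g ⊕ Fin g) (Fin g ⊕ Fin g) ℤ) :
    Nat.card (mapMatrixHom (prinPeriod Z'') (prinPeriod Z) (A₂ * A₁)).ker =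
      Nat.card (mapMatrixHom (prinPeriod Z') (prinPeriod Z) A₂).ker *
        Nat.card (mapMatrixHom (prinPeriod Z'') (prinPeriod Z') A₁).ker := by
  rw [natCard_ker_mapMatrixHom, natCard_ker_mapMatrixHom, natCard_ker_mapMatrixHom, Matrix.det_mul, Int.natAbs_mul]

variable {Z Z' Z''}

/-- The degree of an isogeny is `≥ 1` (a finite non-empty kernel). [cite: Lange2023AbelianVarietiesComplex, §1.1.2 (p0021 L25–L27: «the degree … the order of the group `Ker f`»)] -/
theorem one_le_natCard_ker_of_isIsogeny {A : Matrix (Fin g ⊕ Fin g) (Fin g ⊕ Fin g) ℤ}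
    (hA : IsIsogeny (prinPeriod Z') (prinPeriod Z) A) :
    1 ≤ Nat.card (mapMatrixHom (prinPeriod Z') (prinPeriod Z) A).ker := by
  haveI := hA.finite_ker
  exact Nat.card_pos

/-- Every element of the degree set `D(Z', Z)` is `≥ 1`. [cite: Orr2013, §3 (p0008 L14)] -/
theorem one_le_of_mem_setOf_natCard_ker_isIsogeny {d : ℕ}
    (hd : d ∈ {d : ℕ | ∃ A : Matrix (Fin g ⊕ Fin g) (Fin g ⊕ Fin g) ℤ, IsIsogeny (prinPeriod Z') (prinPeriod Z) A ∧
      Nat.card (mapMatrixHom (prinPeriod Z') (prinPeriod Z) A).ker = d}) : 1 ≤ d := by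
  obtain ⟨A, hA, rfl⟩ := hd
  exact one_le_natCard_ker_of_isIsogeny hA

variable (Z Z') in
/-- **`D(Z', Z) ≠ ∅ ⟺ X_{Z'} ∼ X_Z`.** [cite: Orr2013, §3 (p0008 L14: «complexity of a point `t ∈ Λ`», `Λ` the isogeny class)] -/
theorem setOf_natCard_ker_isIsogeny_nonempty_iff :
    {d : ℕ | ∃ A : Matrix (Fin g ⊕ Fin g) (Fin g ⊕ Fin g) ℤ, IsIsogeny (prinPeriod Z') (prinPeriod Z) A ∧
      Nat.card (mapMatrixHom (prinPeriod Z') (prinPeriod Z) A).ker = d}.Nonempty ↔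
      IsIsogenous (prinPeriod Z') (prinPeriod Z) :=
  ⟨fun ⟨_, A, hA, _⟩ ↦ ⟨A, hA⟩, fun ⟨A, hA⟩ ↦ ⟨_, A, hA, rfl⟩⟩

variable (Z Z') in
/-- **THE COMPLEXITY EXISTS: on an isogeny class the degree set has a least element** («the minimum degree of an
isogeny `A_s → A_t`»). [cite: Orr2013, §3 (p0008 L14)] -/
theorem exists_isLeast_setOf_natCard_ker_isIsogeny (h : IsIsogenous (prinPeriod Z') (prinPeriod Z)) :
    ∃ c : ℕ, IsLeast {d : ℕ | ∃ A : Matrix (Fin g ⊕ Fin g) (Fin g ⊕ Fin g) ℤ, IsIsogeny (prinPeriod Z') (prinPeriod Z) A ∧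
      Nat.card (mapMatrixHom (prinPeriod Z') (prinPeriod Z) A).ker = d} c := by
  have hne := (setOf_natCard_ker_isIsogeny_nonempty_iff Z Z').2 h
  exact ⟨_, Nat.sInf_mem hne, fun d hd ↦ Nat.sInf_le hd⟩

end DegreeSet

/-! ## §2 Complexity `1` iff isomorphic -/

section One

variable (Z Z' : siegelUpperHalfSpace g)

/-- **`1 ∈ D(Z', Z)` IFF `X_{Z'} ≅ X_Z`**: an isogeny of degree `1` has `det = ±1`, hence an integer inverse, and its
analytic representation is a `ℂ`-linear isomorphism (Exercise 1.1.6 (5)(b)); conversely an isomorphism is `ρ(R)`,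
`R ∈ GL_{2g}(ℤ)`, an isogeny of degree `|det R| = 1`. [cite: Lange2023AbelianVarietiesComplex, §1.1.6 Exercise (5)(b) (p0027) and §1.1.2 Prop. 1.1.13 (p0022)] [cite: Orr2013, §3 (p0008 L14)] -/
theorem exists_isIsogeny_natCard_ker_eq_one_iff_isIsomorphic :
    (∃ A : Matrix (Fin g ⊕ Fin g) (Fin g ⊕ Fin g) ℤ, IsIsogeny (prinPeriod Z') (prinPeriod Z) A ∧
      Nat.card (mapMatrixHom (prinPeriod Z') (prinPeriod Z) A).ker = 1) ↔
      IsIsomorphic (prinPeriod Z') (prinPeriod Z) := by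
  constructor
  · rintro ⟨A, hA, h1⟩
    rw [natCard_ker_mapMatrixHom] at h1
    have hu : IsUnit A.det := Int.isUnit_iff_natAbs_eq.2 h1
    obtain ⟨f, hf⟩ := hA.exists_analyticRep
    exact isIsomorphic_of_matrix (Matrix.nonsing_inv_mul A hu) (Matrix.mul_nonsing_inv A hu) f hf
  · intro h
    obtain ⟨A, B, C, hBA, -, hC⟩ := h.exists_matrix
    have hdet : A.det.natAbs = 1 := by
      have h1 := congrArg Matrix.det hBA
      rw [Matrix.det_mul, Matrix.det_one] at h1
      exact Int.isUnit_iff_natAbs_eq.1 (isUnit_of_dvd_one ⟨B.det, by rw [mul_comm]; exact h1.symm⟩)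
    refine ⟨A, (isIsogeny_iff_det_ne_zero _ _ A).2 ⟨⟨(C : (Fin g → ℂ) →L[ℂ] (Fin g → ℂ)), hC⟩, ?_⟩, ?_⟩
    · intro h0; rw [h0, Int.natAbs_zero] at hdet; exact zero_ne_one hdet
    · rw [natCard_ker_mapMatrixHom, hdet]

/-- **COMPLEXITY `1` IFF ISOMORPHIC: `IsLeast D(Z', Z) 1 ⟺ X_{Z'} ≅ X_Z`** (degrees are `≥ 1`).
[cite: Orr2013, §3 (p0008 L14)] [cite: Lange2023AbelianVarietiesComplex, §1.1.6 Exercise (5)(b) (p0027)] -/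
theorem isLeast_setOf_natCard_ker_isIsogeny_one_iff :
    IsLeast {d : ℕ | ∃ A : Matrix (Fin g ⊕ Fin g) (Fin g ⊕ Fin g) ℤ, IsIsogeny (prinPeriod Z') (prinPeriod Z) A ∧
      Nat.card (mapMatrixHom (prinPeriod Z') (prinPeriod Z) A).ker = d} 1 ↔
      IsIsomorphic (prinPeriod Z') (prinPeriod Z) := by
  rw [← exists_isIsogeny_natCard_ker_eq_one_iff_isIsomorphic]
  exact ⟨fun h ↦ h.1, fun h ↦ ⟨h, fun d hd ↦ one_le_of_mem_setOf_natCard_ker_isIsogeny hd⟩⟩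

end One

/-! ## §3 Submultiplicativity -/

section Submultiplicative

variable {Z Z' Z'' : siegelUpperHalfSpace g}

/-- **`D(Z', Z) · D(Z'', Z') ⊆ D(Z'', Z)`**: isogenies compose and degrees multiply.
[cite: Lange2023AbelianVarietiesComplex, §1.1.2 Prop. 1.1.13 and Cor. 1.1.16 (a) (p0022)] [cite: Orr2013, §3 (p0008 L14)] -/
theorem mul_mem_setOf_natCard_ker_isIsogeny {d₁ d₂ : ℕ}
    (h₁ : d₁ ∈ {d : ℕ | ∃ A : Matrix (Fin g ⊕ Fin g) (Fin g ⊕ Fin g) ℤ, IsIsogeny (prinPeriod Z'') (prinPeriod Z') A ∧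
      Nat.card (mapMatrixHom (prinPeriod Z'') (prinPeriod Z') A).ker = d})
    (h₂ : d₂ ∈ {d : ℕ | ∃ A : Matrix (Fin g ⊕ Fin g) (Fin g ⊕ Fin g) ℤ, IsIsogeny (prinPeriod Z') (prinPeriod Z) A ∧
      Nat.card (mapMatrixHom (prinPeriod Z') (prinPeriod Z) A).ker = d}) :
    d₂ * d₁ ∈ {d : ℕ | ∃ A : Matrix (Fin g ⊕ Fin g) (Fin g ⊕ Fin g) ℤ, IsIsogeny (prinPeriod Z'') (prinPeriod Z) A ∧
      Nat.card (mapMatrixHom (prinPeriod Z'') (prinPeriod Z) A).ker = d} := by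
  obtain ⟨A₁, hA₁, rfl⟩ := h₁
  obtain ⟨A₂, hA₂, rfl⟩ := h₂
  exact ⟨A₂ * A₁, hA₂.mul (prinPeriod Z'') (prinPeriod Z') (prinPeriod Z) hA₁, natCard_ker_mul Z Z' Z'' A₂ A₁⟩

/-- **ORR'S COMPLEXITY IS SUBMULTIPLICATIVE: `c(Z'', Z) ≤ c(Z', Z) · c(Z'', Z')`** for the least degrees.
[cite: Orr2013, §3 (p0008 L14)] [cite: Lange2023AbelianVarietiesComplex, §1.1.2 Prop. 1.1.13 and Cor. 1.1.16 (a) (p0022)] -/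
theorem isLeast_le_mul_of_isLeast {c c₁ c₂ : ℕ}
    (hc : IsLeast {d : ℕ | ∃ A : Matrix (Fin g ⊕ Fin g) (Fin g ⊕ Fin g) ℤ, IsIsogeny (prinPeriod Z'') (prinPeriod Z) A ∧
      Nat.card (mapMatrixHom (prinPeriod Z'') (prinPeriod Z) A).ker = d} c)
    (hc₁ : IsLeast {d : ℕ | ∃ A : Matrix (Fin g ⊕ Fin g) (Fin g ⊕ Fin g) ℤ, IsIsogeny (prinPeriod Z'') (prinPeriod Z') A ∧
      Nat.card (mapMatrixHom (prinPeriod Z'') (prinPeriod Z') A).ker = d} c₁)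
    (hc₂ : IsLeast {d : ℕ | ∃ A : Matrix (Fin g ⊕ Fin g) (Fin g ⊕ Fin g) ℤ, IsIsogeny (prinPeriod Z') (prinPeriod Z) A ∧
      Nat.card (mapMatrixHom (prinPeriod Z') (prinPeriod Z) A).ker = d} c₂) :
    c ≤ c₂ * c₁ :=
  hc.2 (mul_mem_setOf_natCard_ker_isIsogeny hc₁.1 hc₂.1)

end Submultiplicative

/-! ## §4 `Sp_{2g}(ℤ)`-bi-invariance: the complexity descends to `𝒜_g` -/

section Invariance

variable {Z₁ Z₂ : siegelUpperHalfSpace g}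

/-- **The degree set `D(·, Z)` depends only on the isomorphism class of the source**: `X_{Z₁} ≅ X_{Z₂}` implies
`D(Z₁, Z) = D(Z₂, Z)` (compose with the degree-`1` isogenies `X_{Z₁} ⇄ X_{Z₂}`).
[cite: Orr2013, §3 (p0008 L14–L15)] [cite: Lange2023AbelianVarietiesComplex, §1.1.6 Exercise (5)(b) (p0027)] -/
theorem setOf_natCard_ker_isIsogeny_eq_of_isIsomorphic_left (h : IsIsomorphic (prinPeriod Z₁) (prinPeriod Z₂))
    (Z : siegelUpperHalfSpace g) :
    {d : ℕ | ∃ A : Matrix (Fin g ⊕ Fin g) (Fin g ⊕ Fin g) ℤ, IsIsogeny (prinPeriod Z₁) (prinPeriod Z) A ∧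
      Nat.card (mapMatrixHom (prinPeriod Z₁) (prinPeriod Z) A).ker = d} =
    {d : ℕ | ∃ A : Matrix (Fin g ⊕ Fin g) (Fin g ⊕ Fin g) ℤ, IsIsogeny (prinPeriod Z₂) (prinPeriod Z) A ∧
      Nat.card (mapMatrixHom (prinPeriod Z₂) (prinPeriod Z) A).ker = d} := by
  obtain ⟨R, hR, hR1⟩ := (exists_isIsogeny_natCard_ker_eq_one_iff_isIsomorphic Z₂ Z₁).2 h
  obtain ⟨S, hS, hS1⟩ := (exists_isIsogeny_natCard_ker_eq_one_iff_isIsomorphic Z₁ Z₂).2 h.symm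
  ext d
  constructor
  · rintro ⟨A, hA, rfl⟩
    exact ⟨A * S, hA.mul (prinPeriod Z₂) (prinPeriod Z₁) (prinPeriod Z) hS, by rw [natCard_ker_mul, hS1, mul_one]⟩
  · rintro ⟨A, hA, rfl⟩
    exact ⟨A * R, hA.mul (prinPeriod Z₁) (prinPeriod Z₂) (prinPeriod Z) hR, by rw [natCard_ker_mul, hR1, mul_one]⟩

/-- **The degree set `D(Z', ·)` depends only on the isomorphism class of the target.**
[cite: Orr2013, §3 (p0008 L14–L15)] [cite: Lange2023AbelianVarietiesComplex, §1.1.6 Exercise (5)(b) (p0027)] -/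
theorem setOf_natCard_ker_isIsogeny_eq_of_isIsomorphic_right (h : IsIsomorphic (prinPeriod Z₁) (prinPeriod Z₂))
    (Z' : siegelUpperHalfSpace g) :
    {d : ℕ | ∃ A : Matrix (Fin g ⊕ Fin g) (Fin g ⊕ Fin g) ℤ, IsIsogeny (prinPeriod Z') (prinPeriod Z₁) A ∧
      Nat.card (mapMatrixHom (prinPeriod Z') (prinPeriod Z₁) A).ker = d} =
    {d : ℕ | ∃ A : Matrix (Fin g ⊕ Fin g) (Fin g ⊕ Fin g) ℤ, IsIsogeny (prinPeriod Z') (prinPeriod Z₂) A ∧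
      Nat.card (mapMatrixHom (prinPeriod Z') (prinPeriod Z₂) A).ker = d} := by
  obtain ⟨R, hR, hR1⟩ := (exists_isIsogeny_natCard_ker_eq_one_iff_isIsomorphic Z₂ Z₁).2 h
  obtain ⟨S, hS, hS1⟩ := (exists_isIsogeny_natCard_ker_eq_one_iff_isIsomorphic Z₁ Z₂).2 h.symm
  ext d
  constructor
  · rintro ⟨A, hA, rfl⟩
    exact ⟨R * A, hR.mul (prinPeriod Z') (prinPeriod Z₁) (prinPeriod Z₂) hA, by rw [natCard_ker_mul, hR1, one_mul]⟩
  · rintro ⟨A, hA, rfl⟩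
    exact ⟨S * A, hS.mul (prinPeriod Z') (prinPeriod Z₂) (prinPeriod Z₁) hA, by rw [natCard_ker_mul, hS1, one_mul]⟩

/-- **`Sp_{2g}(ℤ)`-INVARIANCE IN THE SOURCE: `D(M·Z', Z) = D(Z', Z)` for `M ∈ Sp_{2g}(ℤ)`** (`X_{M(Z')} ≅ X_{Z'}`,
Thm. 3.1.12) — «we may also talk about the complexity of a point in `Λ̃`, meaning the complexity of its image in `Λ`».
[cite: Orr2013, §3 (p0008 L14–L15)] [cite: Lange2023AbelianVarietiesComplex, §3.1.4 Thm. 3.1.12, Remark 3.1.14 (p0162–p0163)] -/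
theorem setOf_natCard_ker_isIsogeny_smul_of_mem_siegelModularGroup_left {M : Matrix.symplecticGroup (Fin g) ℝ}
    (hM : M ∈ siegelModularGroup g) (Z' Z : siegelUpperHalfSpace g) :
    {d : ℕ | ∃ A : Matrix (Fin g ⊕ Fin g) (Fin g ⊕ Fin g) ℤ, IsIsogeny (prinPeriod (M • Z')) (prinPeriod Z) A ∧
      Nat.card (mapMatrixHom (prinPeriod (M • Z')) (prinPeriod Z) A).ker = d} =
    {d : ℕ | ∃ A : Matrix (Fin g ⊕ Fin g) (Fin g ⊕ Fin g) ℤ, IsIsogeny (prinPeriod Z') (prinPeriod Z) A ∧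
      Nat.card (mapMatrixHom (prinPeriod Z') (prinPeriod Z) A).ker = d} :=
  setOf_natCard_ker_isIsogeny_eq_of_isIsomorphic_left (isIsomorphic_prinPeriod_smul_of_mem_siegelModularGroup hM Z') Z

/-- **`Sp_{2g}(ℤ)`-INVARIANCE IN THE TARGET: `D(Z', M·Z) = D(Z', Z)` for `M ∈ Sp_{2g}(ℤ)`** — together with the
previous theorem, Orr's complexity is a function on `𝒜_g × 𝒜_g`. [cite: Orr2013, §3 (p0008 L14–L15)] [cite: Lange2023AbelianVarietiesComplex, §3.1.4 Thm. 3.1.12, Remark 3.1.14 (p0162–p0163)] -/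
theorem setOf_natCard_ker_isIsogeny_smul_of_mem_siegelModularGroup_right {M : Matrix.symplecticGroup (Fin g) ℝ}
    (hM : M ∈ siegelModularGroup g) (Z' Z : siegelUpperHalfSpace g) :
    {d : ℕ | ∃ A : Matrix (Fin g ⊕ Fin g) (Fin g ⊕ Fin g) ℤ, IsIsogeny (prinPeriod Z') (prinPeriod (M • Z)) A ∧
      Nat.card (mapMatrixHom (prinPeriod Z') (prinPeriod (M • Z)) A).ker = d} =
    {d : ℕ | ∃ A : Matrix (Fin g ⊕ Fin g) (Fin g ⊕ Fin g) ℤ, IsIsogeny (prinPeriod Z') (prinPeriod Z) A ∧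
      Nat.card (mapMatrixHom (prinPeriod Z') (prinPeriod Z) A).ker = d} :=
  setOf_natCard_ker_isIsogeny_eq_of_isIsomorphic_right (isIsomorphic_prinPeriod_smul_of_mem_siegelModularGroup hM Z) Z'

/-- **The complexity is `Sp_{2g}(ℤ)`-bi-invariant**: `IsLeast D(M·Z', N·Z) c ⟺ IsLeast D(Z', Z) c` for `M, N ∈ Sp_{2g}(ℤ)`.
[cite: Orr2013, §3 (p0008 L14–L15)] [cite: Lange2023AbelianVarietiesComplex, §3.1.4 Thm. 3.1.12, Remark 3.1.14 (p0162–p0163)] -/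
theorem isLeast_setOf_natCard_ker_isIsogeny_smul_iff {M N : Matrix.symplecticGroup (Fin g) ℝ}
    (hM : M ∈ siegelModularGroup g) (hN : N ∈ siegelModularGroup g) (Z' Z : siegelUpperHalfSpace g) (c : ℕ) :
    IsLeast {d : ℕ | ∃ A : Matrix (Fin g ⊕ Fin g) (Fin g ⊕ Fin g) ℤ, IsIsogeny (prinPeriod (M • Z')) (prinPeriod (N • Z)) A ∧
      Nat.card (mapMatrixHom (prinPeriod (M • Z')) (prinPeriod (N • Z)) A).ker = d} c ↔
    IsLeast {d : ℕ | ∃ A : Matrix (Fin g ⊕ Fin g) (Fin g ⊕ Fin g) ℤ, IsIsogeny (prinPeriod Z') (prinPeriod Z) A ∧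
      Nat.card (mapMatrixHom (prinPeriod Z') (prinPeriod Z) A).ker = d} c := by
  rw [setOf_natCard_ker_isIsogeny_smul_of_mem_siegelModularGroup_left hM,
    setOf_natCard_ker_isIsogeny_smul_of_mem_siegelModularGroup_right hN]

end Invariance

end SiegelModuli

end Literature.AlgebraicGeometry.ModuliOfAbelianVarieties

end
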